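import Summits.ValiantsHypothesis.ValiantsHypothesis.Theorems.LacunarySymmetroidMatrixDescartesDoorA26WallBubblingTightIntervals
import Summits.ValiantsHypothesis.ValiantsHypothesis.Theorems.LacunarySymmetroidMatrixDescartesDoorA26WallBubblingChainCeilingTight
import Summits.ValiantsHypothesis.ValiantsHypothesis.Theorems.LacunarySymmetroidMatrixDescartesDoorA26WallBubblingBubblingNormalisation

/-!
# Wall bubbling for `DoorA26` — (W-split) structure, part B5: THE END-CLUSTER LAW (a singleton end cluster sits on the triple, Weyl pair extreme)

HONEST FRAMING.  Bookkeeping lemmas for obligation (W) `stub_weylFaces` of `Cruxes/DoorA26/Lines/wall_bubbling.lean` (stmt-ValiantsHypothesis-19979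
`DoorA26`; OPEN, typed, never asserted), W2 seat val-sym-door-p1 g15; named residual `NoTightChain26` of `Cruxes/DoorA26/Lines/wall_bubbling_ConfluentDoor.lean`
rev 4/5.  They pin down the END profiles of a tight chain (`…WallBubblingTightChain.tightChain` #26 + `interval_count_tight` #28):

* `end_cluster_top` / `end_cluster_bottom` — abstract (value currency of #17): in a tight chain (nonempty monotone `Λ c ⊆ V`, `Σ_c(|Λ c| − 1) = |V| − 1`,
  every cluster L–P-sharp `m c + 1 = Σ_{Λ c}(d c w + 1)`), a LAST cluster active on a single value is active on the MAXIMUM of `V` and carries exactly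
  `m = d(max V)` zeros; mirror for a FIRST cluster and the minimum.
* `weyl_top_of_confluent_max` / `weyl_bottom_of_confluent_min` — the member-language dictionary at a generic Weyl face (positions `0, 5`): if the
  maximal pair-sum value carries an alive CONFLUENT slot of the limit letters `W` (which `m ≥ 1 = d ≥ 1` forces, by B1's degrees), then that value is
  the triple `2·δ0 0` and the Weyl exponent `δ0 0` is the TOP exponent; mirror at the bottom.

CONSEQUENCE (the flag of report §70 (c), now by name): with `m c ≥ 1` (#22) a two-cluster tight chain whose top cluster sees one value has the Weyl
pair on top, `Λ_top = {2δ0 0}`, `m_top = d_top(2δ0 0) ∈ {1, 2}`, and by tight slot splitting the bottom cluster carries the triple with confluent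
degree `2 − m_top`: the profiles (19,1) [t²-slot dead below — rev 4's `ConfluentDoor26TopDeficit`] and (18,2) [t- AND t²-slot dead below — not covered
by rev 4's doors]; mirrors (1,19), (2,18) at the bottom.  Nothing here kills a chain.

No new definitions; nothing here bears on `DoorA26`, `MatrixDescartes` (stmt-ValiantsHypothesis-18050) or `VP ≠ VNP`; (W)/(W-split)/`ConfluentDoor26`/`NoTightChain26` OPEN.

[folklore] bookkeeping.  [this work] the end-cluster law.
-/

-- `Summit.ValiantsHypothesis.ValiantsHypothesis.…` repeats a component by the D-0017 layout
-- (single-conjunct summit), which the `dupNamespace` linter flags; the name is mandated.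
set_option linter.dupNamespace false

namespace Summit.ValiantsHypothesis.ValiantsHypothesis.Theorems.LacunarySymmetroidMatrixDescartes.WallBubbling

open Finset
open Bubbling (polar polar_comm)
open scoped BigOperators

/-! ## 1. Abstract end-cluster law -/

/-- **END-CLUSTER LAW, TOP.**  In a tight chain, a last cluster active on a single value is active on `max V` and carries `m = d (max V)` zeros.
[this work] -/
theorem end_cluster_top (V : Finset ℝ) {C : ℕ} (Λ : Fin C → Finset ℝ) (d : Fin C → ℝ → ℕ) (m : Fin C → ℕ)
    (hne : ∀ c, (Λ c).Nonempty) (hsub : ∀ c, Λ c ⊆ V) (hmono : ∀ c c', c < c' → ∀ w ∈ Λ c, ∀ w' ∈ Λ c', w ≤ w')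
    (hC : 0 < C) (htight : ∑ c, ((Λ c).card - 1) = V.card - 1)
    (hsharp : ∀ c, m c + 1 = ∑ w ∈ Λ c, (d c w + 1))
    (c : Fin C) (hlast : ∀ c' : Fin C, c' ≤ c) (h1 : (Λ c).card = 1) :
    ∃ w, Λ c = {w} ∧ w ∈ V ∧ (∀ v ∈ V, v ≤ w) ∧ m c = d c w := by
  obtain ⟨w, hw⟩ := Finset.card_eq_one.mp h1
  obtain ⟨hcover, -, -⟩ := interval_count_tight V Λ hne hsub hmono hC htight
  refine ⟨w, hw, hsub c (by rw [hw]; exact Finset.mem_singleton_self w), fun v hv => ?_, ?_⟩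
  · obtain ⟨c', hc'⟩ := hcover v hv
    rcases (hlast c').lt_or_eq with hlt | heq
    · exact hmono c' c hlt v hc' w (by rw [hw]; exact Finset.mem_singleton_self w)
    · rw [heq, hw, Finset.mem_singleton] at hc'
      exact hc'.le
  · have := hsharp c
    rw [hw, Finset.sum_singleton] at this
    omega

/-- **END-CLUSTER LAW, BOTTOM** (mirror). [this work] -/
theorem end_cluster_bottom (V : Finset ℝ) {C : ℕ} (Λ : Fin C → Finset ℝ) (d : Fin C → ℝ → ℕ) (m : Fin C → ℕ)
    (hne : ∀ c, (Λ c).Nonempty) (hsub : ∀ c, Λ c ⊆ V) (hmono : ∀ c c', c < c' → ∀ w ∈ Λ c, ∀ w' ∈ Λ c', w ≤ w')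
    (hC : 0 < C) (htight : ∑ c, ((Λ c).card - 1) = V.card - 1)
    (hsharp : ∀ c, m c + 1 = ∑ w ∈ Λ c, (d c w + 1))
    (c : Fin C) (hfirst : ∀ c' : Fin C, c ≤ c') (h1 : (Λ c).card = 1) :
    ∃ w, Λ c = {w} ∧ w ∈ V ∧ (∀ v ∈ V, w ≤ v) ∧ m c = d c w := by
  obtain ⟨w, hw⟩ := Finset.card_eq_one.mp h1
  obtain ⟨hcover, -, -⟩ := interval_count_tight V Λ hne hsub hmono hC htight
  refine ⟨w, hw, hsub c (by rw [hw]; exact Finset.mem_singleton_self w), fun v hv => ?_, ?_⟩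
  · obtain ⟨c', hc'⟩ := hcover v hv
    rcases (hfirst c').lt_or_eq with hlt | heq
    · exact hmono c c' hlt w (by rw [hw]; exact Finset.mem_singleton_self w) v hc'
    · rw [← heq, hw, Finset.mem_singleton] at hc'
      exact hc'.ge
  · have := hsharp c
    rw [hw, Finset.sum_singleton] at this
    omega

/-! ## 2. Member-language dictionary: a confluent slot at an extreme value puts the Weyl pair at that extreme -/

/-- **TOP.**  At a generic Weyl face (positions `0, 5`, `δ0 5 = δ0 0`, 2-Sidon off `5`): if the MAXIMAL pair-sum value `w` carries an alive confluent
slot of `W` (B1's degree `d w ≥ 1`: either `w = 2δ0 0` with the `t²`-slot alive, or a `t`-slot `(5,q)`, `q ≠ 5`, of value `w` alive), then `w` is the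
triple `2·δ0 0` and `δ0 0` is the largest exponent. [this work] -/
theorem weyl_top_of_confluent_max (δ0 : Fin 6 → ℝ) (h05 : δ0 5 = δ0 0)
    (hsid : ∀ a b c d : Fin 5, δ0 a.castSucc + δ0 b.castSucc = δ0 c.castSucc + δ0 d.castSucc → (a = c ∧ b = d) ∨ (a = d ∧ b = c))
    (W : Fin 6 → Matrix (Fin 2) (Fin 2) ℝ) (w : ℝ) (hmax : ∀ p q : Fin 6, δ0 p + δ0 q ≤ w)
    (hconf : (δ0 0 + δ0 0 = w ∧ polar (W 5) (W 5) ≠ 0) ∨ (∃ q : Fin 6, q ≠ 5 ∧ δ0 5 + δ0 q = w ∧ polar (W 5) (W q) ≠ 0)) :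
    w = δ0 0 + δ0 0 ∧ ∀ l : Fin 6, δ0 l ≤ δ0 0 := by
  have key : w = δ0 0 + δ0 0 := by
    rcases hconf with ⟨h, -⟩ | ⟨q, hq5, hq, -⟩
    · exact h.symm
    · -- `w = δ0 0 + δ0 q` is maximal, so `δ0 q ≥ δ0 0` and `δ0 0 ≥ δ0 q`
      rw [h05] at hq
      have h1 := hmax q q
      have h2 := hmax 0 0
      have heq : δ0 q = δ0 0 := by linarith
      have := weyl_pos_inj δ0 hsid 0 q (by decide) hq5 heq
      subst this
      exact hq.symm
  refine ⟨key, fun l => ?_⟩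
  have := hmax l l
  rw [key] at this
  linarith

/-- **BOTTOM** (mirror): if the MINIMAL pair-sum value carries an alive confluent slot, it is the triple and `δ0 0` is the smallest exponent.
[this work] -/
theorem weyl_bottom_of_confluent_min (δ0 : Fin 6 → ℝ) (h05 : δ0 5 = δ0 0)
    (hsid : ∀ a b c d : Fin 5, δ0 a.castSucc + δ0 b.castSucc = δ0 c.castSucc + δ0 d.castSucc → (a = c ∧ b = d) ∨ (a = d ∧ b = c))
    (W : Fin 6 → Matrix (Fin 2) (Fin 2) ℝ) (w : ℝ) (hmin : ∀ p q : Fin 6, w ≤ δ0 p + δ0 q)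
    (hconf : (δ0 0 + δ0 0 = w ∧ polar (W 5) (W 5) ≠ 0) ∨ (∃ q : Fin 6, q ≠ 5 ∧ δ0 5 + δ0 q = w ∧ polar (W 5) (W q) ≠ 0)) :
    w = δ0 0 + δ0 0 ∧ ∀ l : Fin 6, δ0 0 ≤ δ0 l := by
  have key : w = δ0 0 + δ0 0 := by
    rcases hconf with ⟨h, -⟩ | ⟨q, hq5, hq, -⟩
    · exact h.symm
    · rw [h05] at hq
      have h1 := hmin q q
      have h2 := hmin 0 0
      have heq : δ0 q = δ0 0 := by linarith
      have := weyl_pos_inj δ0 hsid 0 q (by decide) hq5 heq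
      subst this
      exact hq.symm
  refine ⟨key, fun l => ?_⟩
  have := hmin l l
  rw [key] at this
  linarith

/-- **The degree at an extreme singleton cluster is `1` or `2`** (B1's degree expression takes values in `{0,1,2}`; `m = d ≥ 1`): bookkeeping for the
profile list (19,1)/(18,2). [folklore] -/
theorem confluent_degree_cases (δ0 : Fin 6 → ℝ) (W : Fin 6 → Matrix (Fin 2) (Fin 2) ℝ) (w : ℝ) (m : ℕ) (hm1 : 1 ≤ m)
    (hm : m = (if δ0 0 + δ0 0 = w ∧ polar (W 5) (W 5) ≠ 0 then 2
      else if (∃ q : Fin 6, q ≠ 5 ∧ δ0 5 + δ0 q = w ∧ polar (W 5) (W q) ≠ 0) then 1 else 0)) :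
    (m = 2 ∧ polar (W 5) (W 5) ≠ 0) ∨
    (m = 1 ∧ polar (W 5) (W 5) = 0 ∧ ∃ q : Fin 6, q ≠ 5 ∧ δ0 5 + δ0 q = w ∧ polar (W 5) (W q) ≠ 0) ∨
    (m = 1 ∧ δ0 0 + δ0 0 ≠ w ∧ ∃ q : Fin 6, q ≠ 5 ∧ δ0 5 + δ0 q = w ∧ polar (W 5) (W q) ≠ 0) := by
  by_cases h1 : δ0 0 + δ0 0 = w ∧ polar (W 5) (W 5) ≠ 0
  · rw [if_pos h1] at hm
    exact Or.inl ⟨hm, h1.2⟩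
  · rw [if_neg h1] at hm
    by_cases h2 : ∃ q : Fin 6, q ≠ 5 ∧ δ0 5 + δ0 q = w ∧ polar (W 5) (W q) ≠ 0
    · rw [if_pos h2] at hm
      by_cases hw : δ0 0 + δ0 0 = w
      · have h55 : polar (W 5) (W 5) = 0 := by
          by_contra h; exact h1 ⟨hw, h⟩
        exact Or.inr (Or.inl ⟨hm, h55, h2⟩)
      · exact Or.inr (Or.inr ⟨hm, hw, h2⟩)
    · rw [if_neg h2] at hm
      omega

end Summit.ValiantsHypothesis.ValiantsHypothesis.Theorems.LacunarySymmetroidMatrixDescartes.WallBubbling
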